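/-
Copyright (c) 2026 the pub-hodgecm-mathlib formalisation cell (harness21).  Prover seat hodgecm-mathlib-F0P3a-p07 (g19): ROAD «HC-D» (holder F0P2-p01 (g23)),
brick D5(iv)+GLOBAL, generic supplier (G-FUB), 2026-09-02.
-/
import Mathlib.MeasureTheory.Measure.Haar.Unique
import Mathlib.MeasureTheory.Function.LocallyIntegrable
import Mathlib.MeasureTheory.Integral.Lebesgue.Map
import Mathlib.MeasureTheory.Measure.Prod
import HarnessLib

/-!
# Local finiteness of `∫⁻` transfers along a product splitting of Haar measure

Topic `MeasureTheory/Group`; namespace `Literature.MeasureTheory.Group`.  THEOREMS ONLY (no definition, no instance, no notation, no named fact, no `sorry`);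
Mathlib + `HarnessLib` only.  Cell `pub/hodgecm-mathlib`, crux H413 = `stmt-HodgeConjecture-24833` (lane `--supports`, count-neutral), ROAD «HC-D» (holder F0P2-p01 (g23)),
brick **D5(iv)+GLOBAL** (hand F0P3a-p07 (g19)), generic supplier **(G-FUB)**: the `𝔷`-Fubini step «`|η|^{−1∕2}` locally integrable on the trace-zero part `𝔲₀` ⇒ on
`𝔲 = 𝔷 ⊕ 𝔲₀`» (RULING R3 16:24:15Z) and the final conversion to Mathlib's `LocallyIntegrable`.  HONEST LABEL: HC_CM is proved only modulo the 7 printed citations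
(2 remaining: hLiu418 = `stmt-HodgeConjecture-24832`, h413 = `stmt-HodgeConjecture-24833`) until rung 0 closes; this file closes no organ.

## The statements (no scalar field anywhere)

`Z`, `V'`, `V` are locally compact, second-countable ADDITIVE topological groups with their Borel σ-algebras (`Z` Hausdorff), `e : Z × V' ≃ₜ+ V` a continuous additive
isomorphism, `μZ`, `μ'`, `μ` ANY additive Haar measures on `Z`, `V'`, `V` (no compatibility is asked: by uniqueness of Haar measure `μ` and `e_*(μZ ⊗ μ')` are positive finite
multiples of each other, and the constant is absorbed).  For `f : V → ℝ≥0∞` and `g : V' → ℝ≥0∞` measurable with `f (e (z, y)) = g y` («`f` does not depend on the `Z`-coordinate»)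
write `LF μ f x` for «`∃ U ∈ 𝓝 x, ∫⁻ v in U, f v ∂μ < ∞`» (spelled out in every statement).  Then

* §1 `exists_nhds_setLIntegral_lt_top_of_prod`: `LF μ' g y → LF μ f (e (z, y))` (integrate over `e '' (K ×ˢ U')`, `K` a compact neighbourhood of `z`: Tonelli gives
  `c · μZ K · ∫⁻_{U'} g`); `exists_nhds_setLIntegral_lt_top_of_prod_symm`: `LF μ f (e (z, y)) → LF μ' g y` (a neighbourhood of `e (z, y)` contains some `e '' (A ×ˢ U')` with
  `μZ A > 0`); `forall_exists_nhds_setLIntegral_lt_top_iff_of_prod`: `(∀ x, LF μ f x) ↔ (∀ y, LF μ' g y)`.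
* §1′ `exists_nhds_setLIntegral_lt_top_iff_of_addEquiv` ∕ `forall_…_iff_of_addEquiv`: the one-factor twin along a single `Φ : W ≃ₜ+ V` (transport of the vertex
  lemma ★ (D3v) from coordinates `Fin n → F′` to `↥𝔲₀` along the coordinate isomorphism (CO) of ROAD «HC-D»).
* §2 `forall_exists_nhds_setLIntegral_lt_top_of_off_range` — the ASSEMBLY SHAPE of ROAD «HC-D» D5(iv): if `LF μ f x` holds at every `x` OFF the «centre» `e '' (Z × {0})` and the
  vertex implication «`LF μ' g y` for all `y ≠ 0` ⇒ for all `y`» holds on `V'`, then `LF μ f x` for every `x`.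
* §3 `locallyIntegrable_of_forall_exists_nhds_setLIntegral_enorm_lt_top` (+ the dominated form): `∀ x, ∃ U ∈ 𝓝 x, ∫⁻ v in U, ‖φ v‖ₑ ∂μ < ∞` ⇒ `LocallyIntegrable φ μ` for an
  a.e.-strongly measurable `φ : V → E` — the bridge to the `hDGliO` token of RUNG0 (RULING R2: D7 compares the real integrand with `ηι` pointwise).

## References
* [Folland1999] G. B. Folland, *Real Analysis* (2nd ed., 1999), §2.5 Thm. 2.37 (Tonelli), §11.1 Thm. 11.9 (uniqueness of Haar measure).
* [DeitmarEchterhoff2014] A. Deitmar, S. Echterhoff, *Principles of Harmonic Analysis* (2nd ed., 2014), §1.5 Thm. 1.5.3 (quotient integral formula; here the split case).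
-/

set_option autoImplicit false

noncomputable section

open MeasureTheory MeasureTheory.Measure Set Filter Topology
open scoped ENNReal NNReal Topology

namespace Literature.MeasureTheory.Group

section ProductTransfer

variable {Z V' V : Type*}
  [TopologicalSpace Z] [AddGroup Z] [IsTopologicalAddGroup Z] [LocallyCompactSpace Z] [T2Space Z] [SecondCountableTopology Z]
  [MeasurableSpace Z] [BorelSpace Z]
  [TopologicalSpace V'] [AddGroup V'] [IsTopologicalAddGroup V'] [LocallyCompactSpace V'] [SecondCountableTopology V']
  [MeasurableSpace V'] [BorelSpace V']
  [TopologicalSpace V] [AddGroup V] [IsTopologicalAddGroup V] [LocallyCompactSpace V] [SecondCountableTopology V]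
  [MeasurableSpace V] [BorelSpace V]
  (e : Z × V' ≃ₜ+ V) (μ' : Measure V') (μ : Measure V) [μ'.IsAddHaarMeasure] [μ.IsAddHaarMeasure]

/-! ## §1 Transfer of local finiteness along `e : Z × V' ≃ₜ+ V` -/

omit [IsTopologicalAddGroup Z] [LocallyCompactSpace Z] [T2Space Z] [SecondCountableTopology Z] [IsTopologicalAddGroup V'] [LocallyCompactSpace V']
  [IsTopologicalAddGroup V] [LocallyCompactSpace V] [SecondCountableTopology V] [μ'.IsAddHaarMeasure] in
/-- The set integral over an `e`-image against the transported product measure is the product integral (change of variables along the measurable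
equivalence `e`). [cite: Folland1999, §2.5 Thm. 2.37] -/
theorem setLIntegral_image_map_prod_eq (μZ : Measure Z) (f : V → ℝ≥0∞) (S : Set (Z × V')) :
    ∫⁻ v in e '' S, f v ∂((μZ.prod μ').map e) = ∫⁻ p in S, f (e p) ∂(μZ.prod μ') := by
  set em : Z × V' ≃ᵐ V := e.toHomeomorph.toMeasurableEquiv with hem
  have hcoe : (em : Z × V' → V) = e := rfl
  rw [show ((μZ.prod μ').map e) = (μZ.prod μ').map em by rw [hcoe], ← hcoe, em.restrict_map, lintegral_map_equiv,
    show em ⁻¹' (em '' S) = S from em.injective.preimage_image S]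

omit [T2Space Z] [BorelSpace Z] [BorelSpace V'] in
/-- Tonelli for an integrand depending only on the `V'`-coordinate: `∫⁻_{A ×ˢ U'} g(y) d(μZ ⊗ μ') = μZ A · ∫⁻_{U'} g`. [cite: Folland1999, §2.5 Thm. 2.37] -/
theorem setLIntegral_prod_snd_eq (μZ : Measure Z) [μZ.IsAddHaarMeasure] {g : V' → ℝ≥0∞} (hg : Measurable g) (A : Set Z) (U' : Set V') :
    ∫⁻ p in A ×ˢ U', g p.2 ∂(μZ.prod μ') = μZ A * ∫⁻ y in U', g y ∂μ' := by
  rw [← Measure.prod_restrict, lintegral_prod (fun p : Z × V' => g p.2) (hg.comp measurable_snd).aemeasurable]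
  simp only [lintegral_const, Measure.restrict_apply_univ]
  rw [mul_comm]

/-- **LOCAL FINITENESS ASCENDS**: if `g` has finite integral on a neighbourhood of `y`, then `f = g ∘ pr₂ ∘ e⁻¹` has finite integral on a neighbourhood of `e (z, y)`, for
every `z` (the neighbourhood `e '' (K ×ˢ U')`, `K` a compact neighbourhood of `z`; `μ = c • e_*(μZ ⊗ μ')` by uniqueness of Haar measure; Tonelli).
[cite: Folland1999, §11.1 Thm. 11.9] [cite: DeitmarEchterhoff2014, §1.5 Thm. 1.5.3] -/
theorem exists_nhds_setLIntegral_lt_top_of_prod (μZ : Measure Z) [μZ.IsAddHaarMeasure] {f : V → ℝ≥0∞} {g : V' → ℝ≥0∞} (hg : Measurable g)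
    (hfg : ∀ z y, f (e (z, y)) = g y) (z : Z) {y : V'} (hy : ∃ U ∈ 𝓝 y, ∫⁻ v in U, g v ∂μ' < ∞) :
    ∃ U ∈ 𝓝 (e (z, y)), ∫⁻ v in U, f v ∂μ < ∞ := by
  obtain ⟨U₁, hU₁, hU₁i⟩ := hy
  -- shrink to an open neighbourhood
  obtain ⟨U', hU'U, hU'o, hyU'⟩ := mem_nhds_iff.1 hU₁
  have hU'i : ∫⁻ v in U', g v ∂μ' < ∞ := lt_of_le_of_lt (lintegral_mono_set hU'U) hU₁i
  -- a compact neighbourhood of `z`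
  obtain ⟨K, hKc, hKz⟩ := exists_compact_mem_nhds z
  have hKm : MeasurableSet K := hKc.measurableSet
  -- the transported product Haar measure and the uniqueness constant
  haveI : ((μZ.prod μ').map e).IsAddHaarMeasure := e.isAddHaarMeasure_map (μZ.prod μ')
  obtain ⟨c, hc⟩ : ∃ c : ℝ≥0, μ = c • (μZ.prod μ').map e := ⟨_, isAddLeftInvariant_eq_smul μ _⟩
  refine ⟨e '' (K ×ˢ U'), ?_, ?_⟩
  · exact e.toHomeomorph.isOpenMap.image_mem_nhds (prod_mem_nhds hKz (hU'o.mem_nhds hyU'))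
  · have hint : ∫⁻ p in K ×ˢ U', f (e p) ∂(μZ.prod μ') = ∫⁻ p in K ×ˢ U', g p.2 ∂(μZ.prod μ') :=
      setLIntegral_congr_fun (hKm.prod hU'o.measurableSet) (fun p _ => by rw [show p = (p.1, p.2) from rfl, hfg])
    rw [hc, Measure.restrict_smul, lintegral_smul_measure, setLIntegral_image_map_prod_eq, hint,
      setLIntegral_prod_snd_eq μ' μZ hg K U']
    exact ENNReal.nnreal_smul_lt_top (ENNReal.mul_lt_top hKc.measure_lt_top hU'i)

omit [T2Space Z] in
/-- **LOCAL FINITENESS DESCENDS**: if `f` has finite integral on a neighbourhood of `e (z, y)`, then `g` has finite integral on a neighbourhood of `y` (that neighbourhood contains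
some `e '' (A ×ˢ U')` with `A ∈ 𝓝 z` open, hence `μZ A > 0`). [cite: Folland1999, §11.1 Thm. 11.9] [cite: DeitmarEchterhoff2014, §1.5 Thm. 1.5.3] -/
theorem exists_nhds_setLIntegral_lt_top_of_prod_symm (μZ : Measure Z) [μZ.IsAddHaarMeasure] {f : V → ℝ≥0∞} {g : V' → ℝ≥0∞} (hg : Measurable g)
    (hfg : ∀ z y, f (e (z, y)) = g y) {z : Z} {y : V'} (hx : ∃ U ∈ 𝓝 (e (z, y)), ∫⁻ v in U, f v ∂μ < ∞) :
    ∃ U ∈ 𝓝 y, ∫⁻ v in U, g v ∂μ' < ∞ := by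
  obtain ⟨W, hW, hWi⟩ := hx
  -- pull the neighbourhood back and find an open product box inside
  have hW' : (e : Z × V' → V) ⁻¹' W ∈ 𝓝 (z, y) := e.continuous.continuousAt.preimage_mem_nhds hW
  obtain ⟨A₁, hA₁, U₁, hU₁, hAU⟩ := mem_nhds_prod_iff.1 hW'
  obtain ⟨A, hAA₁, hAo, hzA⟩ := mem_nhds_iff.1 hA₁
  obtain ⟨U', hU'U₁, hU'o, hyU'⟩ := mem_nhds_iff.1 hU₁
  have hsub : e '' (A ×ˢ U') ⊆ W := by
    rintro _ ⟨p, hp, rfl⟩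
    exact hAU (Set.prod_mono hAA₁ hU'U₁ hp)
  -- the transported product Haar measure is a finite multiple of `μ`
  haveI : ((μZ.prod μ').map e).IsAddHaarMeasure := e.isAddHaarMeasure_map (μZ.prod μ')
  obtain ⟨c, hc⟩ : ∃ c : ℝ≥0, (μZ.prod μ').map e = c • μ := ⟨_, isAddLeftInvariant_eq_smul _ μ⟩
  have hfin : ∫⁻ v in e '' (A ×ˢ U'), f v ∂((μZ.prod μ').map e) < ∞ := by
    rw [hc, Measure.restrict_smul, lintegral_smul_measure]
    exact ENNReal.nnreal_smul_lt_top (lt_of_le_of_lt (lintegral_mono_set hsub) hWi)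
  rw [setLIntegral_image_map_prod_eq] at hfin
  have hint : ∫⁻ p in A ×ˢ U', f (e p) ∂(μZ.prod μ') = ∫⁻ p in A ×ˢ U', g p.2 ∂(μZ.prod μ') :=
    setLIntegral_congr_fun (hAo.measurableSet.prod hU'o.measurableSet) (fun p _ => by rw [show p = (p.1, p.2) from rfl, hfg])
  rw [hint, setLIntegral_prod_snd_eq μ' μZ hg A U'] at hfin
  have hApos : μZ A ≠ 0 := (measure_pos_of_mem_nhds μZ (hAo.mem_nhds hzA)).ne'
  refine ⟨U', hU'o.mem_nhds hyU', ?_⟩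
  rcases ENNReal.mul_lt_top_iff.1 hfin with h | h | h
  · exact h.2
  · exact absurd h hApos
  · rw [h]; exact ENNReal.zero_lt_top

/-- **THE TRANSFER IS AN EQUIVALENCE**: `f` is locally `∫⁻`-finite at every point of `V` iff `g` is at every point of `V'`. [cite: Folland1999, §11.1 Thm. 11.9] -/
theorem forall_exists_nhds_setLIntegral_lt_top_iff_of_prod (μZ : Measure Z) [μZ.IsAddHaarMeasure] {f : V → ℝ≥0∞} {g : V' → ℝ≥0∞}
    (hg : Measurable g) (hfg : ∀ z y, f (e (z, y)) = g y) :
    (∀ x : V, ∃ U ∈ 𝓝 x, ∫⁻ v in U, f v ∂μ < ∞) ↔ (∀ y : V', ∃ U ∈ 𝓝 y, ∫⁻ v in U, g v ∂μ' < ∞) := by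
  constructor
  · intro h y
    exact exists_nhds_setLIntegral_lt_top_of_prod_symm e μ' μ μZ hg hfg (z := 0) (h (e (0, y)))
  · intro h x
    obtain ⟨p, rfl⟩ := e.surjective x
    exact exists_nhds_setLIntegral_lt_top_of_prod e μ' μ μZ hg hfg p.1 (h p.2)

/-! ## §2 The assembly shape: off-centre local finiteness + the vertex implication -/

/-- **ASSEMBLY**: if `f` is locally `∫⁻`-finite at every point OFF the «centre» `e '' (Z × {0})`, and on `V'` local finiteness at all `y ≠ 0` implies local finiteness at
every `y` (the vertex∕homogeneity step), then `f` is locally `∫⁻`-finite everywhere (off-centre points descend to `y ≠ 0`, the vertex step closes `y = 0`, everything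
ascends). [cite: Folland1999, §11.1 Thm. 11.9] -/
theorem forall_exists_nhds_setLIntegral_lt_top_of_off_range (μZ : Measure Z) [μZ.IsAddHaarMeasure] {f : V → ℝ≥0∞} {g : V' → ℝ≥0∞}
    (hg : Measurable g) (hfg : ∀ z y, f (e (z, y)) = g y)
    (hoff : ∀ x : V, x ∉ Set.range (fun z : Z => e (z, 0)) → ∃ U ∈ 𝓝 x, ∫⁻ v in U, f v ∂μ < ∞)
    (hvertex : (∀ y : V', y ≠ 0 → ∃ U ∈ 𝓝 y, ∫⁻ v in U, g v ∂μ' < ∞) → ∀ y : V', ∃ U ∈ 𝓝 y, ∫⁻ v in U, g v ∂μ' < ∞) :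
    ∀ x : V, ∃ U ∈ 𝓝 x, ∫⁻ v in U, f v ∂μ < ∞ := by
  refine (forall_exists_nhds_setLIntegral_lt_top_iff_of_prod e μ' μ μZ hg hfg).2 (hvertex fun y hy => ?_)
  refine exists_nhds_setLIntegral_lt_top_of_prod_symm e μ' μ μZ hg hfg (z := 0) (hoff _ ?_)
  rintro ⟨z, hz⟩
  have h := e.injective hz
  rw [Prod.mk.injEq] at h
  exact hy h.2.symm

end ProductTransfer

/-! ## §1′ The one-factor twin: transfer along a single `Φ : W ≃ₜ+ V` -/

section OneFactor

variable {W V : Type*}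
  [TopologicalSpace W] [AddGroup W] [IsTopologicalAddGroup W] [MeasurableSpace W] [BorelSpace W]
  [TopologicalSpace V] [AddGroup V] [IsTopologicalAddGroup V] [LocallyCompactSpace V] [SecondCountableTopology V]
  [MeasurableSpace V] [BorelSpace V]
  (Φ : W ≃ₜ+ V) (μW : Measure W) (μ : Measure V) [μW.IsAddHaarMeasure] [μ.IsAddHaarMeasure]

omit [IsTopologicalAddGroup W] [IsTopologicalAddGroup V] [LocallyCompactSpace V] [SecondCountableTopology V] [μW.IsAddHaarMeasure] [μ.IsAddHaarMeasure] in
/-- Change of variables for a set integral over a `Φ`-image against the transported measure. [cite: Folland1999, §2.5 Thm. 2.37] -/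
theorem setLIntegral_image_map_eq (f : V → ℝ≥0∞) (S : Set W) :
    ∫⁻ v in Φ '' S, f v ∂(μW.map Φ) = ∫⁻ w in S, f (Φ w) ∂μW := by
  set em : W ≃ᵐ V := Φ.toHomeomorph.toMeasurableEquiv with hem
  have hcoe : (em : W → V) = Φ := rfl
  rw [show (μW.map Φ) = μW.map em by rw [hcoe], ← hcoe, em.restrict_map, lintegral_map_equiv,
    show em ⁻¹' (em '' S) = S from em.injective.preimage_image S]

/-- **TRANSFER ALONG ONE ADDITIVE HOMEOMORPHISM**: for ANY add-Haar measures `μW` on `W` and `μ` on `V` and `Φ : W ≃ₜ+ V`, `f` has finite integral near `Φ w`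
iff `f ∘ Φ` has finite integral near `w` (`Φ_* μW = c • μ` and `μ`… by uniqueness of Haar measure, both ways). ROAD «HC-D»: carries ★ (D3v)'s vertex lemma on
`Fin n → F′` to `↥𝔲₀` along the coordinate isomorphism (CO). [cite: Folland1999, §11.1 Thm. 11.9] -/
theorem exists_nhds_setLIntegral_lt_top_iff_of_addEquiv (f : V → ℝ≥0∞) (w : W) :
    (∃ U ∈ 𝓝 (Φ w), ∫⁻ v in U, f v ∂μ < ∞) ↔ (∃ U ∈ 𝓝 w, ∫⁻ v in U, f (Φ v) ∂μW < ∞) := by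
  haveI : (μW.map Φ).IsAddHaarMeasure := Φ.isAddHaarMeasure_map μW
  constructor
  · rintro ⟨U, hU, hUi⟩
    obtain ⟨c, hc⟩ : ∃ c : ℝ≥0, μW.map Φ = c • μ := ⟨_, isAddLeftInvariant_eq_smul _ μ⟩
    refine ⟨Φ ⁻¹' U, Φ.continuous.continuousAt.preimage_mem_nhds hU, ?_⟩
    rw [← setLIntegral_image_map_eq Φ μW, Φ.surjective.image_preimage U, hc, Measure.restrict_smul, lintegral_smul_measure]
    exact ENNReal.nnreal_smul_lt_top hUi
  · rintro ⟨U, hU, hUi⟩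
    obtain ⟨c, hc⟩ : ∃ c : ℝ≥0, μ = c • μW.map Φ := ⟨_, isAddLeftInvariant_eq_smul μ _⟩
    refine ⟨Φ '' U, Φ.toHomeomorph.isOpenMap.image_mem_nhds hU, ?_⟩
    rw [hc, Measure.restrict_smul, lintegral_smul_measure, setLIntegral_image_map_eq Φ μW]
    exact ENNReal.nnreal_smul_lt_top hUi

/-- **POINTWISE-EVERYWHERE form**: `(∀ x, f finite near x) ↔ (∀ w, f ∘ Φ finite near w)`. [cite: Folland1999, §11.1 Thm. 11.9] -/
theorem forall_exists_nhds_setLIntegral_lt_top_iff_of_addEquiv (f : V → ℝ≥0∞) :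
    (∀ x : V, ∃ U ∈ 𝓝 x, ∫⁻ v in U, f v ∂μ < ∞) ↔ (∀ w : W, ∃ U ∈ 𝓝 w, ∫⁻ v in U, f (Φ v) ∂μW < ∞) := by
  constructor
  · intro h w
    exact (exists_nhds_setLIntegral_lt_top_iff_of_addEquiv Φ μW μ f w).1 (h (Φ w))
  · intro h x
    obtain ⟨w, rfl⟩ := Φ.surjective x
    exact (exists_nhds_setLIntegral_lt_top_iff_of_addEquiv Φ μW μ f w).2 (h w)

end OneFactor

/-! ## §3 From local `∫⁻`-finiteness to `LocallyIntegrable` -/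

section LocallyIntegrable

variable {V : Type*} [TopologicalSpace V] [MeasurableSpace V] {E : Type*} [NormedAddCommGroup E] (μ : Measure V)

/-- **`∀ x, ∃ U ∈ 𝓝 x, ∫⁻_U ‖φ‖ₑ < ∞` ⇒ `LocallyIntegrable φ μ`** for an a.e.-strongly measurable `φ` (Mathlib's `LocallyIntegrable` = `IntegrableAtFilter` at every `𝓝 x`).
[cite: Folland1999, §2.5 Thm. 2.37] -/
theorem locallyIntegrable_of_forall_exists_nhds_setLIntegral_enorm_lt_top (φ : V → E) (hφ : AEStronglyMeasurable φ μ)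
    (h : ∀ x : V, ∃ U ∈ 𝓝 x, ∫⁻ v in U, ‖φ v‖ₑ ∂μ < ∞) : LocallyIntegrable φ μ := by
  intro x
  obtain ⟨U, hU, hUi⟩ := h x
  exact ⟨U, hU, hφ.restrict, hUi⟩

/-- **DOMINATED FORM**: if `‖φ v‖ₑ ≤ f v` pointwise and `f` is locally `∫⁻`-finite at every point, then `φ` is locally integrable (RULING R2 of ROAD «HC-D»: compare the real
`hDGliO` integrand with `ηι` pointwise). [cite: Folland1999, §2.5 Thm. 2.37] -/
theorem locallyIntegrable_of_enorm_le_of_forall_exists_nhds_setLIntegral_lt_top (φ : V → E) (hφ : AEStronglyMeasurable φ μ) {f : V → ℝ≥0∞}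
    (hle : ∀ v, ‖φ v‖ₑ ≤ f v) (h : ∀ x : V, ∃ U ∈ 𝓝 x, ∫⁻ v in U, f v ∂μ < ∞) : LocallyIntegrable φ μ := by
  refine locallyIntegrable_of_forall_exists_nhds_setLIntegral_enorm_lt_top μ φ hφ fun x => ?_
  obtain ⟨U, hU, hUi⟩ := h x
  exact ⟨U, hU, lt_of_le_of_lt (lintegral_mono fun v => hle v) hUi⟩

end LocallyIntegrable

end Literature.MeasureTheory.Group

end
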